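import Summits.ResolutionOfSingularities.ResolutionOfSingularities.Theorems.WildQuotientsSummitReductionStubPairNodeThickness
import Literature.AlgebraicGeometry.Resolution.AlterationsFormalNodesHolds
import HarnessLib

/-!
# `WildQuotients.SummitReduction` (stmt-ResolutionOfSingularities-16324), line `FramePerfect`:
# lemmas for stub C1 (`stub_pair_orbitBlowupCentreFlat`) — de Jong 1996, 2.23 + 3.3 in Cohen
# coordinates at a QUASI-SPLIT point, over an arbitrary field

Route `ResolutionOfSingularities/WildQuotients`, crux `SummitReduction`; helper file of the line
skeleton (v8), stub C1. Pure commutative algebra: the any-field analogue of the tree's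
`DeJong1996.SemiStablePair.exists_ringEquiv_nodeDeformationRing_cohen` /
`exists_nodeDeformationRing_prod_pow_compat` (`AlterationsFormalNodesHolds.lean`,
`AlterationsSemiStableCodimTwoBlowupFlat.lean`; there: Situation 4.23 over an algebraically
closed field, at a closed point, with `κ = k`). Setting: a FLAT local homomorphism `A → B` of
Noetherian local rings, essentially of finite type, `A` regular containing a field `k₀`, with
the line's quasi-split datum `(B/𝔪_A B)^ ≅ κ(A)⟦u, v⟧/(uv)` over `κ(A)` (de Jong 1996, 2.23:
"`k(x) = k'`"; de Jong 1997, 5.7), and generators `w₁, …, w_m` of `𝔪_A`, `m = dim A`.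

* `centreFlat_exists_nodeDeformationRing_cohen` — **2.23 in Cohen coordinates with the Remark**:
  Cohen coordinates `eA : Â ≅ Λ = κ(A)⟦T₁, …, T_m⟧`, `wᵢ ↦ Tᵢ` (Matsumura 29.7,
  `exists_ringEquiv_adicCompletion_mvPowerSeries_of_rsop`), `h ∈ 𝔪_Λ` and
  `e : B̂ ≅ Λ⟦u, v⟧/(uv - h)` with `e(a) = C (eA â)` on `A` (Liu 10.3.20,
  `NodalDeformation.exists_ringEquiv_cpl`, the residue fields being equal by
  `exists_sub_mem_maximalIdeal_of_quasiSplit`), carrying `Fitt₁(Ω_{B/A}) B̂` onto `(u, v)` (the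
  Remark of 2.23, `DeJong1996.NodeDeformationRing.map_fittingIdeal_eq_span`);
* `centreFlat_dvd_of_mk_C_mem_span`, `centreFlat_dvd_pow_of_pow_mem_fittingIdeal` — **3.3, "the
  singular locus of `f` traced on `Spec B` maps isomorphically to `V(h) ⊂ Spec A'`"**: if
  `a₀^N ∈ Fitt₁(Ω_{B/A})` then `h ∣ (eA â₀)^N`;
* `centreFlat_exists_nodeDeformationRing_prod_pow_compat` — **2.23 + 3.3**: if a power of
  `∏_{i<r} wᵢ` lies in `Fitt₁(Ω_{B/A})` ("By assumption we have `V(h) ⊂ V(t₁ ⋯ t_r)`"), then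
  `e : B̂ ≅ Λ⟦u, v⟧/(uv - ∏ Tᵢ^{νᵢ})` with `νᵢ = 0` for `i ≥ r`, `wᵢ ↦ Tᵢ`, compatibly with `A`
  ("Therefore we see that `h = ε t₁^{n₁} ⋯ t_r^{n_r}` … We change `Q` into `ε⁻¹Q`").
-/

-- the problem path `ResolutionOfSingularities/ResolutionOfSingularities` makes the conventional
-- namespace repeat a component, which `linter.dupNamespace` flags
set_option linter.dupNamespace false

noncomputable section

open Literature.AlgebraicGeometry.Resolution
open Literature.AlgebraicGeometry.Resolution.DeJong1996
open Literature.AlgebraicGeometry.Resolution.DeJong1996.NodeDeformationRing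
open IsLocalRing NodalDeformation Literature.RingTheory.FittingIdeal

namespace Summit.ResolutionOfSingularities.ResolutionOfSingularities.Theorems

universe u

/-! ## 2.23 in Cohen coordinates at a quasi-split point, with the Remark of 2.23 -/

/-- **de Jong 1996, 2.23 (quasi-split case) in Cohen coordinates, with its Remark, over an
arbitrary field.** Let `A → B` be a flat local homomorphism of Noetherian local rings,
essentially of finite type, with `A` regular of dimension `m` containing a field `k₀`, let
`w₁, …, w_m` generate `𝔪_A`, and suppose the completed closed fibre is the formal node over the
residue field, `(B/𝔪_A B)^ ≅ κ(A)⟦u, v⟧/(uv)` compatibly with `κ(A)` (the line's rendering of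
"quasi-split at `x`"). Then there are Cohen coordinates `eA : Â ≅ Λ = κ(A)⟦T₁, …, T_m⟧` with
`wᵢ ↦ Tᵢ`, an element `h ∈ 𝔪_Λ` and `e : B̂ ≅ Λ⟦u, v⟧/(uv - h)` with `e(a) = C(eA â)` for all
`a ∈ A` ("`B ≅ A⟦u, v⟧/(uv - h)` for some `h ∈ A`"), under which `Fitt₁(Ω_{B/A}) B̂` becomes
`(u, v)` ("the trace of `Sing(f)` on the scheme `Spec B` is given by the ideal `(u, v) ⊂ B`").
[cite: DeJong1996, 2.23 with Remark, pp. 61–62] [cite: Matsumura1987, Thm. 29.7] -/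
theorem centreFlat_exists_nodeDeformationRing_cohen {A B : Type u} [CommRing A] [CommRing B]
    [IsRegularLocalRing A] [IsLocalRing B] [IsNoetherianRing B] [Algebra A B]
    [IsLocalHom (algebraMap A B)] [Algebra.EssFiniteType A B] (hflat : (algebraMap A B).Flat)
    (e : AdicCompletion ((maximalIdeal B).map (Ideal.Quotient.mk
          ((maximalIdeal A).map (algebraMap A B)))) (B ⧸ (maximalIdeal A).map (algebraMap A B)) ≃+*
      MvPowerSeries (Fin 2) (A ⧸ maximalIdeal A) ⧸
        Ideal.span {(MvPowerSeries.X 0 * MvPowerSeries.X 1 :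
          MvPowerSeries (Fin 2) (A ⧸ maximalIdeal A))})
    (he : e.toRingHom.comp ((algebraMap (B ⧸ (maximalIdeal A).map (algebraMap A B)) _).comp
        (Ideal.quotientMap ((maximalIdeal A).map (algebraMap A B)) (algebraMap A B)
          Ideal.le_comap_map)) =
      algebraMap (A ⧸ maximalIdeal A) _)
    (k₀ : Subring A) (hk₀ : IsField k₀) {m : ℕ} (w : Fin m → A)
    (hw : Ideal.span (Set.range w) = maximalIdeal A) (hm : ringKrullDim A = m) :
    ∃ (h : MvPowerSeries (Fin m) (ResidueField A))
      (eA : Cpl A ≃+* MvPowerSeries (Fin m) (ResidueField A))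
      (e' : Cpl B ≃+* NodeDeformationRing (MvPowerSeries (Fin m) (ResidueField A)) h),
      h ∈ maximalIdeal (MvPowerSeries (Fin m) (ResidueField A)) ∧
      (∀ i, eA (algebraMap A (Cpl A) (w i)) = MvPowerSeries.X i) ∧
      (∀ a, e' (algebraMap B (Cpl B) (algebraMap A B a)) =
        Ideal.Quotient.mk _ (MvPowerSeries.C (eA (algebraMap A (Cpl A) a)))) ∧
      ((Module.fittingIdeal B Ω[B⁄A] 1).map (algebraMap B (Cpl B))).map e'.toRingHom =
        Ideal.span {Ideal.Quotient.mk _ (MvPowerSeries.X 0),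
          Ideal.Quotient.mk _ (MvPowerSeries.X 1)} := by
  -- the residue fields agree
  have hres' := exists_sub_mem_maximalIdeal_of_quasiSplit (algebraMap A B) e he
  have hres : Function.Surjective ((residue B).comp (algebraMap A B)) := by
    intro r
    obtain ⟨b, rfl⟩ := residue_surjective r
    obtain ⟨a, ha⟩ := hres' b
    refine ⟨a, ?_⟩
    rw [RingHom.comp_apply]
    change Ideal.Quotient.mk _ _ = Ideal.Quotient.mk _ _
    rw [Ideal.Quotient.mk_eq_mk_iff_sub_mem, ← neg_sub]
    exact Submodule.neg_mem _ ha
  -- 2.23 (Liu 10.3.20): `e₀ : Â⟦u, v⟧/(uv - h₀) ≅ B̂` over `Â → B̂`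
  obtain ⟨h₀, e₀, -, hC⟩ := NodalDeformation.exists_ringEquiv_cpl (algebraMap A B) hres hflat e
  have hΨ : ∀ a : A, e₀.symm (algebraMap B (Cpl B) (algebraMap A B a)) =
      Ideal.Quotient.mk _ (MvPowerSeries.C (algebraMap A (Cpl A) a)) := by
    intro a
    apply e₀.injective
    rw [RingEquiv.apply_symm_apply, hC, NodalDeformation.complMap_algebraMap]
  -- the Remark of 2.23
  have hF := DeJong1996.NodeDeformationRing.map_fittingIdeal_eq_span hres' e₀.symm hΨ
  -- Cohen coordinates adapted to `w`
  obtain ⟨eA, heA⟩ := exists_ringEquiv_adicCompletion_mvPowerSeries_of_rsop A k₀ hk₀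
    (RingEquiv.refl (ResidueField A)) w hw hm
  let e' := e₀.symm.trans (congr eA h₀ (eA h₀) rfl)
  have he' : ∀ a, e' (algebraMap B (Cpl B) (algebraMap A B a)) =
      Ideal.Quotient.mk _ (MvPowerSeries.C (eA (algebraMap A (Cpl A) a))) := fun a => by
    change congr eA h₀ (eA h₀) rfl (e₀.symm _) = _
    rw [hΨ, congr_mk_C]
  refine ⟨eA h₀, eA, e', ?_, heA, he', ?_⟩
  · exact mem_maximalIdeal_of_ringEquiv e'
  · change ((Module.fittingIdeal B Ω[B⁄A] 1).map (algebraMap B (Cpl B))).map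
        ((congr eA h₀ (eA h₀) rfl).toRingHom.comp e₀.symm.toRingHom) = _
    rw [← Ideal.map_map, hF, Ideal.map_span, Set.image_pair, RingEquiv.toRingHom_eq_coe,
      RingHom.coe_coe, congr_mk_X, congr_mk_X]

/-! ## 3.3: `h` divides a power of the local equation of `D` -/

/-- In `P⟦u, v⟧/(uv - h)`: if the constant `a` lies in `(u, v)` then `h ∣ a` (reduce modulo
`(u, v)`, onto `P/(h)`). [folklore] -/
theorem centreFlat_dvd_of_mk_C_mem_span {P : Type u} [CommRing P] {h a : P}
    (ha : (Ideal.Quotient.mk _ (MvPowerSeries.C a) : NodeDeformationRing P h) ∈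
      Ideal.span {(Ideal.Quotient.mk _ (MvPowerSeries.X 0) : NodeDeformationRing P h),
        Ideal.Quotient.mk _ (MvPowerSeries.X 1)}) : h ∣ a := by
  have hle : Ideal.span {(Ideal.Quotient.mk _ (MvPowerSeries.X 0) : NodeDeformationRing P h),
      Ideal.Quotient.mk _ (MvPowerSeries.X 1)} ≤ RingHom.ker (toBaseQuotient P h) := by
    rw [Ideal.span_le]
    rintro z hz
    simp only [Set.mem_insert_iff, Set.mem_singleton_iff] at hz
    rcases hz with rfl | rfl <;> exact toBaseQuotient_mk_X h _
  have h1 := hle ha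
  rw [RingHom.mem_ker, toBaseQuotient_mk_C, Ideal.Quotient.eq_zero_iff_mem,
    Ideal.mem_span_singleton] at h1
  exact h1

/-- **de Jong 1996, 3.3 ("the singular locus of `f` traced on `Spec B` maps isomorphically to
the closed subscheme `V(h) ⊂ Spec A'`")**, in the form: with `e : B̂ ≅ Λ⟦u, v⟧/(uv - h)` over
`eA : Â ≅ Λ` carrying `Fitt₁(Ω_{B/A}) B̂` onto `(u, v)`, if `a₀^N ∈ Fitt₁(Ω_{B/A})` for some
`a₀ ∈ A` then `h ∣ (eA â₀)^N`. [cite: DeJong1996, 3.3, p. 63] -/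
theorem centreFlat_dvd_pow_of_pow_mem_fittingIdeal {A B : Type u} [CommRing A] [CommRing B]
    [IsLocalRing A] [IsLocalRing B] [Algebra A B] {Λ : Type u} [CommRing Λ] {h : Λ}
    (eA : Cpl A ≃+* Λ) (e' : Cpl B ≃+* NodeDeformationRing Λ h)
    (he' : ∀ a, e' (algebraMap B (Cpl B) (algebraMap A B a)) =
      Ideal.Quotient.mk _ (MvPowerSeries.C (eA (algebraMap A (Cpl A) a))))
    (hF : ((Module.fittingIdeal B Ω[B⁄A] 1).map (algebraMap B (Cpl B))).map e'.toRingHom =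
      Ideal.span {Ideal.Quotient.mk _ (MvPowerSeries.X 0), Ideal.Quotient.mk _ (MvPowerSeries.X 1)})
    {a₀ : A} {N : ℕ} (hN : (algebraMap A B a₀) ^ N ∈ Module.fittingIdeal B Ω[B⁄A] 1) :
    h ∣ (eA (algebraMap A (Cpl A) a₀)) ^ N := by
  have h1 : e'.toRingHom (algebraMap B (Cpl B) ((algebraMap A B a₀) ^ N)) ∈
      Ideal.span {(Ideal.Quotient.mk _ (MvPowerSeries.X 0) : NodeDeformationRing Λ h),
        Ideal.Quotient.mk _ (MvPowerSeries.X 1)} := by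
    rw [← hF]
    exact Ideal.mem_map_of_mem _ (Ideal.mem_map_of_mem _ hN)
  rw [map_pow, map_pow, RingEquiv.toRingHom_eq_coe, RingHom.coe_coe, he', ← map_pow,
    ← map_pow] at h1
  exact centreFlat_dvd_of_mk_C_mem_span h1

/-! ## 2.23 + 3.3: the model `Λ⟦u, v⟧/(uv - ∏ Tᵢ^{νᵢ})` -/

/-- **de Jong 1996, 2.23 + 3.3 at a quasi-split point, over an arbitrary field, in Cohen
coordinates with the compatibility on the whole base.** In the setting of
`centreFlat_exists_nodeDeformationRing_cohen`, suppose moreover that a power of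
`∏_{i<r} wᵢ` lies in `Fitt₁(Ω_{B/A})` ("By assumption we have `V(h) ⊂ V(t₁ ⋯ t_r)`": the curve is
smooth off the divisor cut out by `t₁ ⋯ t_r`). Then `e : B̂ ≅ Λ⟦u, v⟧/(uv - ∏ Tᵢ^{νᵢ})`,
`Λ = κ(A)⟦T₁, …, T_m⟧`, with `νᵢ = 0` for `i ≥ r`, over Cohen coordinates `eA : Â ≅ Λ`, `wᵢ ↦ Tᵢ`,
with `e(a) = C(eA â)` for every `a ∈ A`: `h ∣ (∏_{i<r} Tᵢ)^N`, so `h = ε ∏ Tᵢ^{nᵢ}` (the `Tᵢ`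
are prime), and "we change `Q` into `ε⁻¹Q`" (`absorbUnit`).
[cite: DeJong1996, 2.23 and 3.3, pp. 61–63] -/
theorem centreFlat_exists_nodeDeformationRing_prod_pow_compat {A B : Type u} [CommRing A]
    [CommRing B] [IsRegularLocalRing A] [IsLocalRing B] [IsNoetherianRing B] [Algebra A B]
    [IsLocalHom (algebraMap A B)] [Algebra.EssFiniteType A B] (hflat : (algebraMap A B).Flat)
    (e : AdicCompletion ((maximalIdeal B).map (Ideal.Quotient.mk
          ((maximalIdeal A).map (algebraMap A B)))) (B ⧸ (maximalIdeal A).map (algebraMap A B)) ≃+*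
      MvPowerSeries (Fin 2) (A ⧸ maximalIdeal A) ⧸
        Ideal.span {(MvPowerSeries.X 0 * MvPowerSeries.X 1 :
          MvPowerSeries (Fin 2) (A ⧸ maximalIdeal A))})
    (he : e.toRingHom.comp ((algebraMap (B ⧸ (maximalIdeal A).map (algebraMap A B)) _).comp
        (Ideal.quotientMap ((maximalIdeal A).map (algebraMap A B)) (algebraMap A B)
          Ideal.le_comap_map)) =
      algebraMap (A ⧸ maximalIdeal A) _)
    (k₀ : Subring A) (hk₀ : IsField k₀) {m : ℕ} (r : ℕ) (w : Fin m → A)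
    (hw : Ideal.span (Set.range w) = maximalIdeal A) (hm : ringKrullDim A = m)
    (hFitt : ∃ N : ℕ, (algebraMap A B (∏ i ∈ Finset.univ.filter (fun i : Fin m => i.val < r), w i)) ^ N ∈
      Module.fittingIdeal B Ω[B⁄A] 1) :
    ∃ (ν : Fin m → ℕ) (eA : Cpl A ≃+* MvPowerSeries (Fin m) (ResidueField A))
      (e' : Cpl B ≃+* NodeDeformationRing (MvPowerSeries (Fin m) (ResidueField A))
        (∏ i, MvPowerSeries.X i ^ ν i)),
      (∀ i : Fin m, r ≤ i.val → ν i = 0) ∧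
      (∀ i, eA (algebraMap A (Cpl A) (w i)) = MvPowerSeries.X i) ∧
      ∀ a, e' (algebraMap B (Cpl B) (algebraMap A B a)) =
        Ideal.Quotient.mk _ (MvPowerSeries.C (eA (algebraMap A (Cpl A) a))) := by
  classical
  obtain ⟨h, eA, e₁, -, heA, he₁, hF⟩ :=
    centreFlat_exists_nodeDeformationRing_cohen hflat e he k₀ hk₀ w hw hm
  haveI : IsDomain (MvPowerSeries (Fin m) (ResidueField A)) := NoZeroDivisors.to_isDomain _
  -- 3.3: `h ∣ (∏_{i<r} Tᵢ)^N`
  set s : Finset (Fin m) := Finset.univ.filter (fun i : Fin m => i.val < r) with hs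
  obtain ⟨N, hN⟩ := hFitt
  have hdvd := centreFlat_dvd_pow_of_pow_mem_fittingIdeal eA e₁ he₁ hF hN
  have hprod : eA (algebraMap A (Cpl A) (∏ i ∈ s, w i)) =
      ∏ i ∈ s, (MvPowerSeries.X i : MvPowerSeries (Fin m) (ResidueField A)) := by
    rw [map_prod, map_prod]
    exact Finset.prod_congr rfl fun i _ => heA i
  rw [hprod, ← Finset.prod_pow] at hdvd
  obtain ⟨nn, ε, hfac⟩ := exists_eq_units_mul_prod_pow_of_dvd_prod_pow s
    (fun i => (MvPowerSeries.X i : MvPowerSeries (Fin m) (ResidueField A)))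
    (fun i _ => MvPowerSeries.prime_X' (ResidueField A) i) N hdvd
  -- reindex the exponents to all of `Fin m`
  let ν : Fin m → ℕ := fun i => if i.val < r then nn i else 0
  have hm₀ : ∏ i ∈ s, (MvPowerSeries.X i : MvPowerSeries (Fin m) (ResidueField A)) ^ nn i =
      ∏ i, MvPowerSeries.X i ^ ν i := by
    rw [hs, Finset.prod_filter]
    refine Finset.prod_congr rfl fun i _ => ?_
    simp only [ν]
    split_ifs <;> simp
  have hrel : Ideal.span {nodeDeformationRelation (MvPowerSeries (Fin m) (ResidueField A)) h} =
      Ideal.span {nodeDeformationRelation (MvPowerSeries (Fin m) (ResidueField A))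
        ((ε : MvPowerSeries (Fin m) (ResidueField A)) * ∏ i ∈ s, MvPowerSeries.X i ^ nn i)} := by
    rw [← hfac]
  have hrel' : Ideal.span {nodeDeformationRelation (MvPowerSeries (Fin m) (ResidueField A))
        (∏ i ∈ s, MvPowerSeries.X i ^ nn i)} =
      Ideal.span {nodeDeformationRelation (MvPowerSeries (Fin m) (ResidueField A))
        (∏ i, MvPowerSeries.X i ^ ν i)} := by
    rw [hm₀]
  refine ⟨ν, eA, ((e₁.trans (Ideal.quotEquivOfEq hrel)).trans (absorbUnit ε _)).trans
      (Ideal.quotEquivOfEq hrel'), fun i hi => ?_, heA, fun a => ?_⟩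
  · simp only [ν]
    rw [if_neg (by omega)]
  · rw [RingEquiv.trans_apply, RingEquiv.trans_apply, RingEquiv.trans_apply, he₁,
      Ideal.quotEquivOfEq_mk, absorbUnit_mk_C, Ideal.quotEquivOfEq_mk]

end Summit.ResolutionOfSingularities.ResolutionOfSingularities.Theorems

end
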